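import Literature.Claims.NS.Akysh2020
import Literature.Analysis.FluidPDE.LambFormCurlKernel
import Literature.Analysis.FluidPDE.TsaiSelfSimilarBounded
import HarnessLib

/-!
# Solo salvage for claim C71 `Akysh2020` (cell `ns-claims`, D-0090): the two TRUE classical identities
# quoted by the note — the Lamb form (p.16) and Liouville for bounded harmonic functions (Thm 5 p.20)

Claim skeleton: `Literature/Claims/NS/Akysh2020.lean` (typist `ns-claims-typist-12`; A. Sh. Akysh,
Bull. Karaganda Univ. Math. 2020 no. 2(98) 15–23). Kernel facts of record (refuter-8):
`…Theorems.Akysh2020.not_Step_S0`, `not_Step_S1`, `not_Step_S1Abs` (the premise `P = −|U|²` and the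
inference (4) ⇒ (5) p.16). This file (seat `ns-claims-salvage-p3`) kernel-discharges the TRUE statements the
note quotes around its failing steps — both classical, both already in the tree in general form:

* `akysh2020_lambFormula_holds : LambFormula` — «(U,∇)U − ∇E = [rot U, U]», p.16 before (4): the Lamb
  form `(v·∇)v = (curl v) × v + ∇(½|v|²)` (Majda–Bertozzi 2002 §2.1 (2.5)); tree
  `convect_self_eq_cross_curl_add_gradient` (`LambFormCurlKernel.lean`).
* `akysh2020_step_S5_holds : Step_S5` — Theorem 5 p.20 («positive harmonic function E is constant»), typed
  as: a smooth BOUNDED function on `ℝ³` with `ΔE = 0` is constant — Liouville (Gilbarg–Trudinger Thm 2.10);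
  tree `isConst_of_harmonic_bounded` (`TsaiSelfSimilarBounded.lean`).

Solo lane (`Theorems/SoloSalvage<Slug>.lean`, no item).

WHAT THIS IS NOT: not a claim about NS regularity or blow-up; not a claim about any author beyond the
typed locator.
-/

noncomputable section

-- The summit-side namespace repeats the summit name by design (D-0017 layout); tree precedent
-- `SoloSalvageLam2019.lean`.
set_option linter.dupNamespace false

open Set Filter Topology InnerProductSpace
open scoped ContDiff

namespace Summit.NavierStokesRegularity.NavierStokesRegularity.Theorems.Akysh2020Salvage

open Literature.Analysis.FluidPDE Literature.Claims.NS.Akysh2020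

/-- **The Lamb form quoted on p.16 holds**: `(V·∇)V − ∇(½|V|²) = (curl V) × V` for smooth `V` at every
point (Majda–Bertozzi 2002 (2.5); tree `convect_self_eq_cross_curl_add_gradient`). -/
theorem akysh2020_lambFormula_holds : Literature.Claims.NS.Akysh2020.LambFormula := by
  intro V hV x
  have hhalf : (fun y => (1 / 2 : ℝ) * ‖V y‖ ^ 2) = fun y => ‖V y‖ ^ 2 / 2 := by
    funext y
    ring
  rw [hhalf, convect_self_eq_cross_curl_add_gradient ((hV.differentiable (by simp)) x),
    add_sub_cancel_right]

/-- **Theorem 5 p.20 as typed holds (Liouville)**: a smooth bounded function on `ℝ³` with vanishing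
Laplacian everywhere is constant (Gilbarg–Trudinger 2001 Thm 2.10; tree `isConst_of_harmonic_bounded`). -/
theorem akysh2020_step_S5_holds : Literature.Claims.NS.Akysh2020.Step_S5 := by
  intro g hg hΔ hB x y
  have hharm : HarmonicOnNhd g univ := fun z _ =>
    ⟨(hg.of_le (by norm_cast)).contDiffAt, Eventually.of_forall fun w => hΔ w⟩
  exact Literature.Analysis.FluidPDE.isConst_of_harmonic_bounded hharm hB x y

end Summit.NavierStokesRegularity.NavierStokesRegularity.Theorems.Akysh2020Salvage

end
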